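import Summits.QuantumFields.BalabanUV.Beta.SecondOrderStepEvalSym
import Summits.QuantumFields.BalabanUV.Beta.CombChartContactFactor

/-!
# `BalabanUV.Beta.SecondOrderStepEvalComb` — binder row D1, RULING R-D1-g35-1 (chart (III′)), brick P6-1: **THE EVALUATED SECOND-ORDER STEP LAW (N7a→N7b) AT THE
# COMB-CHART RESOLVENTS `G′_j = GcombSh Lc j` AND an1's SHIFT `Dsh Lc`** — `SecondOrderStepEvalSym.mmRead_K3OfK_bref_of_lawM` (generic in the resolvent and the border)
# instantiated at `(G′_j, bhKStepSh d Lc (Dsh Lc) j)` with EVERY resolvent∕shift input a THEOREM: spread `spr_GcombSh`, reflection invariance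
# `CombChartResolventRules.refK_coDressKAt_Gsym`, coarse multiplier rows∕columns `GcombSh_inr_row_coarse`∕`_col_coarse`, the four block facts of P2
# (`CombChartContactFactor.comp_bhKStepSh_GcombSh_inl_inr`∕`comp_GcombSh_bhKStepSh_inr_inl`∕`…_inr_inr`×2), `bhKStepSh_mf`∕`_mm`, (Dspr)(Dmm) of `Dsh Lc`
# — the (III′) twin of `SecondOrderStepEvalSym` §Literal (gen 30), with the shift hypotheses (Dspr)(Dnull)(Dmm)(DG) GONE (theorems at `Dsh Lc` ∕ P2)

HONEST FRAMING (cell contract, verbatim): «discharging `BetaPertH` makes Bałaban's UV stability UNCONDITIONAL — a real constructive-QFT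
result; it is NOT the continuum limit and NOT the Clay problem.»  HONEST DEPENDENCY: continuum YM on T⁴ ⇐ BetaPertH ∧ nine spine estimates (0/9 proved);
BetaPertH ⇐ (D1) ∧ (D4) ∧ CAP+tail; G-an2-4 gates asym, D1 and NE2/3/4.
DERIVED cell leaf ([folklore] wiring BY NAME; β sub-cell, BINDER-OWNERS row D1 OWNER `b2b-balaban-beta-an2` gen 36).  No statement of Bałaban's papers, no `[cite:]`,
no `Prop` fact, no `def`; EVERY table letter is a HYPOTHESIS.  First engine of the owner's programme P6 (the (III′) twins of the chart-(II) second-order hR chain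
`SpineRecursiveT2StepSym` → `…WLawSym` → `…T2AllSym` → `…WEndSym(Tables)` → roots `RowD1JointEndSymReflTablesAn1` … `…S2N`; memo `HOME/b2b-balaban-beta-an2/gen36/P6-SCOPING-hR-chain.v1.md`).
Discharges NO binder by itself; RECORD = ROOT M′ p303989 (chart (II)) unchanged; NOT D1, NOT `BetaPertH`, NOT continuum, NOT Clay.
Provenance: β sub-cell, unit beta-an2 gen 36, 2026-08-22 (v1); the §Literal of `SecondOrderStepEvalSym` with `Gsym ↦ GcombSh`, `Dsh ↦ Dsh Lc` and the named (III′) suppliers; no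
existing file touched.
-/

noncomputable section

open Finset
open scoped BigOperators
open Literature.Probability.LatticeModels (Torus.proj)
open Literature.MathematicalPhysics.QuantumFieldTheory
open Literature.MathematicalPhysics.QuantumFieldTheory.Balaban1983to89
open Literature.MathematicalPhysics.QuantumFieldTheory.Balaban1983to89.Beta
open ExpKernelCalculus (MKer comp Decays BiLoc)
open PolarizationSign (reflSign)
open KernelReflection (refK)
open ResolventReflection (bref Φ)
open OneStepResolventKernel (Fib LocStencil)
open OneStepKernelFamily (KInvStep colH)
open BalabanStepJetsSucc (mmRead)
open SecondOrderResponse (dM K2OfK)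
open BalabanStepW2 (K3OfK)
open AveragingContoursRooted (ctr ctrOff ctrOff_mem_box)
open Summit.QuantumFields.BalabanUV.Beta.TameKernelCalculus
open Summit.QuantumFields.BalabanUV.Beta.ChartConjugation (conjV conjW)
open Summit.QuantumFields.BalabanUV.Beta.AxialDressingRooted (one_le_of_neZero)
open Summit.QuantumFields.BalabanUV.Beta.BorderedHessian (bhK spr_bhK bhKStep stepScale stepScale_ne_zero diagK)
open Summit.QuantumFields.BalabanUV.Beta.SymSliceProjectorKernel (symEc)
open Summit.QuantumFields.BalabanUV.Beta.WardLocusCubic (mmSym)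
open Summit.QuantumFields.BalabanUV.Beta.VertexReflectionContact (smul_diagK summable_colH_mul_of_locStencil)
open Summit.QuantumFields.BalabanUV.Beta.SecondOrderContactMmRead (conjW_mmRead_diag_congr mmSym_inl)
open Summit.QuantumFields.BalabanUV.Beta.ChartConjugationDefectEnd (sandwichDefect)
open Summit.QuantumFields.BalabanUV.Beta.SecondOrderContactMmReadDefect (mmRead_K3OfK_bref_sharp_split_defect)
open Summit.QuantumFields.BalabanUV.Beta.SymmetrisedStepJets (Gsym Gsym_apply)
open Summit.QuantumFields.BalabanUV.Beta.SymShiftedSpread (bhKStepSh spr_bhKStepSh)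
open Summit.QuantumFields.BalabanUV.Beta.SymmetrisedDressingReflection (refK_coDressKSymAt_KInvStep)
open Summit.QuantumFields.BalabanUV.Beta.RelInvNullShift (spr_add)
open Summit.QuantumFields.BalabanUV.Beta.RelInvFactorSandwich (spr_Gsym Gsym_inr_row_coarse Gsym_inr_col_coarse comp_bhKStepSh_Gsym_inl_inr
  comp_Gsym_bhKStepSh_inr_inl comp_bhKStepSh_Gsym_inr_inr comp_Gsym_bhKStepSh_inr_inr)
open Summit.QuantumFields.BalabanUV.Beta.E3ContactGenerator (ctGenM summable_colH_mul_ctGenM loc_diagK_dressedGenM)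
open Summit.QuantumFields.BalabanUV.Beta.E3ContactFactor (dressedGenM_zsmul_inr bhKStepSh_mf bhKStepSh_mm)
open Summit.QuantumFields.BalabanUV.Beta.VertexReflectionContact (mmRead_add)
open Summit.QuantumFields.BalabanUV.Beta.GAN24.ThirdJetKernel (mmRead_sub)
open Summit.QuantumFields.BalabanUV.Beta.SecondOrderStepEvalSym (mmRead_K3OfK_bref_of_lawM)
open Summit.QuantumFields.BalabanUV.Beta.CombChartStepJets (GcombSh GcombSh_apply)
open Summit.QuantumFields.BalabanUV.Beta.CombChartContactFactor (spr_GcombSh GcombSh_inr_row_coarse GcombSh_inr_col_coarse comp_bhKStepSh_GcombSh_inl_inr comp_GcombSh_bhKStepSh_inr_inl comp_bhKStepSh_GcombSh_inr_inr comp_GcombSh_bhKStepSh_inr_inr)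
open Summit.QuantumFields.BalabanUV.Beta.CombChartResolventRules (refK_coDressKAt_Gsym)
open Summit.QuantumFields.BalabanUV.Beta.DshAn1 (Dsh Dsh_inr_inr spr_Dsh)

namespace Summit.QuantumFields.BalabanUV.Beta.SecondOrderStepEvalComb

variable {d : ℕ} {Lc : ℕ} [NeZero Lc]


/-- [folklore] **THE EVALUATED SECOND-ORDER STEP LAW FOR THE (0.4) LITERAL'S RESOLVENTS AT EVERY LEVEL** (RULING R-D1-g28-2, memo N7-SCOPE (N7a)→(N7b)):
`Lc` odd; the shift `Dsh` with (Dspr) `Spr Dsh`, (Dnull) `symEc∘Dsh∘symEc = 0`, (Dmm) `Dsh_mm = 0`, (DG) `(G_j∘Dsh)_mf = 0 ∧ (Dsh∘G_j)_fm = 0`; table data: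
the first-order sharp laws of `S` (contact `γ · ctGenM d (bhK Lc + Dsh Lc) α Lc` against `bhKStepSh d Lc (Dsh Lc) j`) and `M` (pure sign), the second-order sharp law
of `W` of similarity shape up to `R`, a localisation rate of `S`, the localisations of `dM`, `W`, `R`, `diagK h`.  Then the level-`(j+1)` field–field table
`mmRead Lc (K3OfK (GcombSh Lc j) Lc S M W …)` obeys the reflection law of SIMILARITY SHAPE against `mmRead Lc (GcombSh Lc j)` with first-order letters
`mmRead Lc (K2OfK …)`, coarse generators `(γ/(stepScale j·Lc^{d+1})) · ctGenM d (bhK Lc + Dsh Lc) α Lc`, second symbol `mmSym Lc h`, MINUS the transported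
remainder, PLUS the `mm`-reads of the four inner sandwich-defect words (displayed; `sandwichDefect (GcombSh Lc j) (bhKStepSh d Lc (Dsh Lc) j) ·`). -/
theorem mmRead_K3OfK_GcombSh_bref_of_law (hLc : Odd Lc) (j : ℕ)
    {α : Fin (d + 1)} (γ : ℝ) {S M : Fin (d + 1) → (Fin (d + 1) → ℤ) → MKer (d + 1) (Fib d)}
    {W R : Fin (d + 1) → (Fin (d + 1) → ℤ) → Fin (d + 1) → (Fin (d + 1) → ℤ) → MKer (d + 1) (Fib d)}
    {h : Fin (d + 1) → (Fin (d + 1) → ℤ) → Fin (d + 1) → (Fin (d + 1) → ℤ) → (Fin (d + 1) → ℤ) → Fib d → ℝ}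
    (hS : ∀ κ u, S κ (bref α κ u) = reflSign α κ • refK (Φ Lc α)
      (S κ u + conjV (bhKStepSh d Lc (Dsh Lc) j) (diagK fun p c => γ * ctGenM d (bhK Lc + Dsh Lc) α Lc κ u p c)))
    (hMt : ∀ ρ w, M ρ (bref α ρ w) = reflSign α ρ • refK (Φ Lc α) (M ρ w))
    (hW : ∀ μ y ν y', W μ (bref α μ y) ν (bref α ν y') = (reflSign α μ * reflSign α ν) • refK (Φ Lc α)
      (W μ y ν y' +
        conjW (bhKStepSh d Lc (Dsh Lc) j) (dM (GcombSh Lc j) Lc S M μ y) (dM (GcombSh Lc j) Lc S M ν y')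
          (diagK fun p c => ∑ κ, ∑' u, colH (GcombSh Lc j) Lc μ y κ u * (γ * ctGenM d (bhK Lc + Dsh Lc) α Lc κ u p c))
          (diagK fun p c => ∑ κ, ∑' u, colH (GcombSh Lc j) Lc ν y' κ u * (γ * ctGenM d (bhK Lc + Dsh Lc) α Lc κ u p c))
          (diagK (h μ y ν y')) + R μ y ν y'))
    (hSl : ∃ Cs δ : ℝ, 0 < δ ∧ LocStencil S Cs δ)
    (hD : ∀ ν y', Loc (dM (GcombSh Lc j) Lc S M ν y')) (hWl : ∀ μ y ν y', Loc (W μ y ν y')) (hRl : ∀ μ y ν y', Loc (R μ y ν y'))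
    (hhl : ∀ μ y ν y', Loc (diagK (h μ y ν y')))
    (μ : Fin (d + 1)) (y : Fin (d + 1) → ℤ) (ν : Fin (d + 1)) (y' : Fin (d + 1) → ℤ) :
    mmRead Lc (K3OfK (GcombSh Lc j) Lc S M W μ (bref α μ y) ν (bref α ν y')) =
      (reflSign α μ * reflSign α ν) • refK (Φ (d := d) Lc α)
        (mmRead Lc (K3OfK (GcombSh Lc j) Lc S M W μ y ν y') +
          conjW (mmRead Lc (GcombSh (d := d) Lc j)) (mmRead Lc (K2OfK (GcombSh Lc j) Lc S M μ y)) (mmRead Lc (K2OfK (GcombSh Lc j) Lc S M ν y'))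
            (diagK fun p c => γ / (stepScale d Lc j * (Lc : ℝ) ^ (d + 1)) * ctGenM d (bhK Lc + Dsh Lc) α Lc μ y p c)
            (diagK fun p c => γ / (stepScale d Lc j * (Lc : ℝ) ^ (d + 1)) * ctGenM d (bhK Lc + Dsh Lc) α Lc ν y' p c)
            (diagK (mmSym Lc (h μ y ν y'))) -
          mmRead Lc (comp (comp (GcombSh Lc j) (R μ y ν y')) (GcombSh Lc j))
          + (mmRead Lc (comp (sandwichDefect (GcombSh Lc j) (bhKStepSh d Lc (Dsh Lc) j)
                  (diagK fun p c => ∑ κ, ∑' u, colH (GcombSh Lc j) Lc μ y κ u * (γ * ctGenM d (bhK Lc + Dsh Lc) α Lc κ u p c)))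
                (comp (dM (GcombSh Lc j) Lc S M ν y') (GcombSh Lc j) -
                  diagK fun p c => ∑ κ, ∑' u, colH (GcombSh Lc j) Lc ν y' κ u * (γ * ctGenM d (bhK Lc + Dsh Lc) α Lc κ u p c)))
            + mmRead Lc (comp (comp (GcombSh Lc j) (dM (GcombSh Lc j) Lc S M μ y +
                  conjV (bhKStepSh d Lc (Dsh Lc) j) (diagK fun p c => ∑ κ, ∑' u, colH (GcombSh Lc j) Lc μ y κ u * (γ * ctGenM d (bhK Lc + Dsh Lc) α Lc κ u p c))))
                (sandwichDefect (GcombSh Lc j) (bhKStepSh d Lc (Dsh Lc) j)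
                  (diagK fun p c => ∑ κ, ∑' u, colH (GcombSh Lc j) Lc ν y' κ u * (γ * ctGenM d (bhK Lc + Dsh Lc) α Lc κ u p c))))
            + mmRead Lc (comp (sandwichDefect (GcombSh Lc j) (bhKStepSh d Lc (Dsh Lc) j)
                  (diagK fun p c => ∑ κ, ∑' u, colH (GcombSh Lc j) Lc ν y' κ u * (γ * ctGenM d (bhK Lc + Dsh Lc) α Lc κ u p c)))
                (comp (dM (GcombSh Lc j) Lc S M μ y) (GcombSh Lc j) -
                  diagK fun p c => ∑ κ, ∑' u, colH (GcombSh Lc j) Lc μ y κ u * (γ * ctGenM d (bhK Lc + Dsh Lc) α Lc κ u p c)))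
            + mmRead Lc (comp (comp (GcombSh Lc j) (dM (GcombSh Lc j) Lc S M ν y' +
                  conjV (bhKStepSh d Lc (Dsh Lc) j) (diagK fun p c => ∑ κ, ∑' u, colH (GcombSh Lc j) Lc ν y' κ u * (γ * ctGenM d (bhK Lc + Dsh Lc) α Lc κ u p c))))
                (sandwichDefect (GcombSh Lc j) (bhKStepSh d Lc (Dsh Lc) j)
                  (diagK fun p c => ∑ κ, ∑' u, colH (GcombSh Lc j) Lc μ y κ u * (γ * ctGenM d (bhK Lc + Dsh Lc) α Lc κ u p c)))))) := by
  have hKr : refK (Φ (d := d) Lc α) (GcombSh (d := d) Lc j) = GcombSh Lc j := by rw [GcombSh_apply]; exact refK_coDressKAt_Gsym hLc j α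
  have hB : Spr (bhK (d := d) Lc + Dsh Lc) := spr_add (spr_bhK (one_le_of_neZero Lc)) (spr_Dsh (one_le_of_neZero Lc))
  exact mmRead_K3OfK_bref_of_lawM (spr_GcombSh j) hKr (spr_bhKStepSh (spr_Dsh (one_le_of_neZero Lc)) j) hB (stepScale d Lc j) (stepScale_ne_zero j)
    (fun x z m b hx => GcombSh_inr_row_coarse j x z m b hx) (fun x z a m hz => GcombSh_inr_col_coarse j x z a m hz)
    (comp_bhKStepSh_GcombSh_inl_inr j) (comp_GcombSh_bhKStepSh_inr_inl j)
    (fun x z m m' hx _ => comp_bhKStepSh_GcombSh_inr_inr j x z m m' hx)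
    (fun x z m m' _ hz => comp_GcombSh_bhKStepSh_inr_inr j x z m m' hz) (bhKStepSh_mf j) (bhKStepSh_mm (fun x' y' κ l => Dsh_inr_inr Lc x' y' κ l) j)
    γ hS hMt hW hSl hD hWl hRl hhl μ y ν y'

/-- [folklore] **THE SAME WITH THE REMAINDER PACKAGED** — the transported remainder and the four inner defect words in ONE kernel
`R₀ := G_j∘R∘G_j − (w₁ + w₂ + w₃ + w₄)`, read through `mmRead Lc` with a minus sign: the shape `… − mmRead N (R₀ κ u κ′ u′)` consumed by the assembly
`SecondOrderStepLawGen.quarticStep_bref_of_laws_gen` (hQ) — so that the literal's level step is a one-line instantiation. -/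
theorem mmRead_K3OfK_GcombSh_bref_of_law' (hLc : Odd Lc) (j : ℕ)
    {α : Fin (d + 1)} (γ : ℝ) {S M : Fin (d + 1) → (Fin (d + 1) → ℤ) → MKer (d + 1) (Fib d)}
    {W R : Fin (d + 1) → (Fin (d + 1) → ℤ) → Fin (d + 1) → (Fin (d + 1) → ℤ) → MKer (d + 1) (Fib d)}
    {h : Fin (d + 1) → (Fin (d + 1) → ℤ) → Fin (d + 1) → (Fin (d + 1) → ℤ) → (Fin (d + 1) → ℤ) → Fib d → ℝ}
    (hS : ∀ κ u, S κ (bref α κ u) = reflSign α κ • refK (Φ Lc α)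
      (S κ u + conjV (bhKStepSh d Lc (Dsh Lc) j) (diagK fun p c => γ * ctGenM d (bhK Lc + Dsh Lc) α Lc κ u p c)))
    (hMt : ∀ ρ w, M ρ (bref α ρ w) = reflSign α ρ • refK (Φ Lc α) (M ρ w))
    (hW : ∀ μ y ν y', W μ (bref α μ y) ν (bref α ν y') = (reflSign α μ * reflSign α ν) • refK (Φ Lc α)
      (W μ y ν y' +
        conjW (bhKStepSh d Lc (Dsh Lc) j) (dM (GcombSh Lc j) Lc S M μ y) (dM (GcombSh Lc j) Lc S M ν y')
          (diagK fun p c => ∑ κ, ∑' u, colH (GcombSh Lc j) Lc μ y κ u * (γ * ctGenM d (bhK Lc + Dsh Lc) α Lc κ u p c))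
          (diagK fun p c => ∑ κ, ∑' u, colH (GcombSh Lc j) Lc ν y' κ u * (γ * ctGenM d (bhK Lc + Dsh Lc) α Lc κ u p c))
          (diagK (h μ y ν y')) + R μ y ν y'))
    (hSl : ∃ Cs δ : ℝ, 0 < δ ∧ LocStencil S Cs δ)
    (hD : ∀ ν y', Loc (dM (GcombSh Lc j) Lc S M ν y')) (hWl : ∀ μ y ν y', Loc (W μ y ν y')) (hRl : ∀ μ y ν y', Loc (R μ y ν y'))
    (hhl : ∀ μ y ν y', Loc (diagK (h μ y ν y')))
    (μ : Fin (d + 1)) (y : Fin (d + 1) → ℤ) (ν : Fin (d + 1)) (y' : Fin (d + 1) → ℤ) :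
    mmRead Lc (K3OfK (GcombSh Lc j) Lc S M W μ (bref α μ y) ν (bref α ν y')) =
      (reflSign α μ * reflSign α ν) • refK (Φ (d := d) Lc α)
        (mmRead Lc (K3OfK (GcombSh Lc j) Lc S M W μ y ν y') +
          conjW (mmRead Lc (GcombSh (d := d) Lc j)) (mmRead Lc (K2OfK (GcombSh Lc j) Lc S M μ y)) (mmRead Lc (K2OfK (GcombSh Lc j) Lc S M ν y'))
            (diagK fun p c => γ / (stepScale d Lc j * (Lc : ℝ) ^ (d + 1)) * ctGenM d (bhK Lc + Dsh Lc) α Lc μ y p c)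
            (diagK fun p c => γ / (stepScale d Lc j * (Lc : ℝ) ^ (d + 1)) * ctGenM d (bhK Lc + Dsh Lc) α Lc ν y' p c)
            (diagK (mmSym Lc (h μ y ν y'))) -
          mmRead Lc (comp (comp (GcombSh Lc j) (R μ y ν y')) (GcombSh Lc j) -
            (comp (sandwichDefect (GcombSh Lc j) (bhKStepSh d Lc (Dsh Lc) j)
                  (diagK fun p c => ∑ κ, ∑' u, colH (GcombSh Lc j) Lc μ y κ u * (γ * ctGenM d (bhK Lc + Dsh Lc) α Lc κ u p c)))
                (comp (dM (GcombSh Lc j) Lc S M ν y') (GcombSh Lc j) -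
                  diagK fun p c => ∑ κ, ∑' u, colH (GcombSh Lc j) Lc ν y' κ u * (γ * ctGenM d (bhK Lc + Dsh Lc) α Lc κ u p c))
              + comp (comp (GcombSh Lc j) (dM (GcombSh Lc j) Lc S M μ y +
                  conjV (bhKStepSh d Lc (Dsh Lc) j) (diagK fun p c => ∑ κ, ∑' u, colH (GcombSh Lc j) Lc μ y κ u * (γ * ctGenM d (bhK Lc + Dsh Lc) α Lc κ u p c))))
                (sandwichDefect (GcombSh Lc j) (bhKStepSh d Lc (Dsh Lc) j)
                  (diagK fun p c => ∑ κ, ∑' u, colH (GcombSh Lc j) Lc ν y' κ u * (γ * ctGenM d (bhK Lc + Dsh Lc) α Lc κ u p c)))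
              + comp (sandwichDefect (GcombSh Lc j) (bhKStepSh d Lc (Dsh Lc) j)
                  (diagK fun p c => ∑ κ, ∑' u, colH (GcombSh Lc j) Lc ν y' κ u * (γ * ctGenM d (bhK Lc + Dsh Lc) α Lc κ u p c)))
                (comp (dM (GcombSh Lc j) Lc S M μ y) (GcombSh Lc j) -
                  diagK fun p c => ∑ κ, ∑' u, colH (GcombSh Lc j) Lc μ y κ u * (γ * ctGenM d (bhK Lc + Dsh Lc) α Lc κ u p c))
              + comp (comp (GcombSh Lc j) (dM (GcombSh Lc j) Lc S M ν y' +
                  conjV (bhKStepSh d Lc (Dsh Lc) j) (diagK fun p c => ∑ κ, ∑' u, colH (GcombSh Lc j) Lc ν y' κ u * (γ * ctGenM d (bhK Lc + Dsh Lc) α Lc κ u p c))))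
                (sandwichDefect (GcombSh Lc j) (bhKStepSh d Lc (Dsh Lc) j)
                  (diagK fun p c => ∑ κ, ∑' u, colH (GcombSh Lc j) Lc μ y κ u * (γ * ctGenM d (bhK Lc + Dsh Lc) α Lc κ u p c)))))) := by
  rw [mmRead_K3OfK_GcombSh_bref_of_law hLc j γ hS hMt hW hSl hD hWl hRl hhl μ y ν y', mmRead_sub, mmRead_add, mmRead_add,
    mmRead_add]
  congr 2
  abel

end Summit.QuantumFields.BalabanUV.Beta.SecondOrderStepEvalComb

end
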